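import Summits.Ventures.YMGap.YM3IR.CarrierBridge
import HarnessLib

/-!
# YM3IR / CarrierFamily — the coupling set Bałaban's family reaches, its block-factor bound, and the factorisation clause

HONEST FRAMING (cell pub-ymgap, track Y4 / YM3-IR, seat ym3ir-theory-1, gen 2).  This file claims NO summit, NO mass gap and
NO part of Bałaban's theorems: it is kernel-checked BOOKKEEPING over `CarrierBridge.lean` — the instantiation, by the UV
side, of the coupling-set parameter `I : Set ℝ` of theory-2's infrared statement, with the two side conditions that statement
asks of it PROVED for Bałaban's family, and the clause tying a theory-2 block family to Bałaban's averaging TYPED (hypothesis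
shape, labelled CONJECTURE as to its inhabitation).  No axioms, no `sorry`.

WHY THIS IS NOVEL (one sentence).  An infrared theorem fed by Bałaban's CMP 102 can only be asked on the couplings and volumes
his family reaches — `β = L^K/(N g²ε₀(g))`, sides `2L^{m+K}` — and stating that index set, its unboundedness and the linear
block-factor bound `L^{K+M'} ≤ N L^{M'}·β` as theorems (rather than prose) is what makes the composed statement honest about
«uniform in WHICH spacings and volumes».

CONTENTS (namespace `Summit.Ventures.YMGap.YM3IR.CarrierBridge`, continued).  `balabanCouplings L 𝔊 eps0 : Set ℝ` (the
coupling set); `betaTree_mem`; `not_bddAbove_balabanCouplings` (PROVED: unbounded above as soon as the family is inhabited —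
the hypothesis `¬ BddAbove I` of theory-2's cofinal composition); `pow_le_mul_betaTree` (PROVED: `L^{K+M'} ≤ (N·L^{M'})·β_S`
from the cell convention `g²ε₀ ≤ 1`, i.e. the clause `b(β) ≤ C_b β` with `C_b = N·L^{M'}` for Bałaban's `K` steps plus `M'`
further ones); `FactorsThroughAveraging W mk 𝔊 eps0` (HYPOTHESIS SHAPE: on Bałaban pairs W's block map is his `K`-fold
averaging followed by a measurable map of the terminal field); `integral_coarseFamily_of_factors` (PROVED payoff: then
theory-2's coarse law IS `ρ_K dV/Z^ε` pushed forward — the clause under which `Crossover3`'s consequent can use its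
antecedent `BalabanUV3 mk`).  Supersedes the provisional shapes `BalabanPair` / `LatticeMassGap3On` / `AgreesWithAveraging`
of `CarrierBridge.lean` §4 for the purposes of the merged statement (those stay as bookkeeping; the cell's restricted target
is theory-2's, with coupling set `balabanCouplings`).
References: T. Bałaban, CMP 102 (1985) 255–275 [cite: Balaban1985UV3]; CMP 98 (1985) 17–51 [cite: Balaban1985Averaging].
-/

noncomputable section

open MeasureTheory
open Literature.MathematicalPhysics.QuantumFieldTheory Balaban1985CMP102 Balaban1985CMP102.Setting
  Balaban1985CMP102.Theorems
open Literature.MathematicalPhysics.QuantumFieldTheory.Balaban1983to89 (GaugeGroup HaarData fieldMeasure)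

namespace Summit.Ventures.YMGap.YM3IR.CarrierBridge

variable {L : ℕ} {G : Type} [GaugeGroup G] [MeasurableSpace G]

variable (L) in
/-- **The coupling set Bałaban's printed family reaches** at terminal spacing `eps0` in the model `𝔊`: the values
`β_S = 1/(N g² ε) = L^K/(N g² eps0(g))` over the family — per `g` a GEOMETRIC sequence (ratio `L`), on tori of side
`2L^{m+K}` only.  This is the UV side's instantiation of theory-2's coupling-set parameter `I`; the STRONGER target over
all `β ≥ β₁` and all sides needs a volume/coupling interpolation nobody claims. [cite: Balaban1985UV3, p.256 L15–18] -/
def balabanCouplings (𝔊 : GroupModel G) (eps0 : ℝ → ℝ) : Set ℝ :=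
  {β | ∃ S : Family L eps0, betaTree 𝔊 S.1 = β}

/-- Every family member's coupling is in the coupling set (bookkeeping). -/
theorem betaTree_mem (𝔊 : GroupModel G) {eps0 : ℝ → ℝ} (S : Family L eps0) :
    betaTree 𝔊 S.1 ∈ balabanCouplings L 𝔊 eps0 := ⟨S, rfl⟩

/-- **The coupling set is unbounded above (PROVED)** as soon as the family is inhabited: from one member (coupling `g`,
`ε₀ = eps0 g > 0`, cell convention `g²ε₀ ≤ 1`) the members with the same `g` and `K' → ∞` have couplings
`L^{K'}/(N g² eps0 g) → ∞` (`L > 1`).  This discharges the hypothesis `¬ BddAbove I` of theory-2's cofinal composition for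
`I = balabanCouplings L 𝔊 eps0`; inhabitation itself is NOT derivable from `BalabanUV3` as typed (an `eps0` with
`g² eps0 g > 1` for all `g` makes the family empty and the printed theorems vacuous) and travels as this hypothesis. [cite: Balaban1985UV3, p.256 L15–18] -/
theorem not_bddAbove_balabanCouplings (𝔊 : GroupModel G) {eps0 : ℝ → ℝ} (h : Nonempty (Family L eps0)) :
    ¬ BddAbove (balabanCouplings L 𝔊 eps0) := by
  obtain ⟨⟨S₀, hS₀⟩⟩ := h
  rintro ⟨B, hB⟩
  have hL : Odd L ∧ 1 < L := S₀.hL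
  have hL1 : (1 : ℝ) < L := by exact_mod_cast hL.2
  have hg : 0 < S₀.g := S₀.g_pos
  have he : 0 < eps0 S₀.g := by
    rw [← hS₀, ← S₀.hK]; exact mul_pos (pow_pos (zero_lt_one.trans hL1) _) S₀.ε_pos
  have hge : S₀.g ^ 2 * eps0 S₀.g ≤ 1 := hS₀ ▸ S₀.gK_le_one
  set c : ℝ := (𝔊.N : ℝ) * (S₀.g ^ 2 * eps0 S₀.g) with hc
  have hc0 : 0 < c := mul_pos (by exact_mod_cast 𝔊.N_pos) (mul_pos (pow_pos hg 2) he)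
  obtain ⟨K, hK⟩ := pow_unbounded_of_one_lt (B * c) hL1
  have hLK : (0 : ℝ) < (L : ℝ) ^ K := pow_pos (zero_lt_one.trans hL1) K
  let S : Scales L :=
    { hL := hL, m := 0, K := K, ε := eps0 S₀.g / (L : ℝ) ^ K, ε_pos := div_pos he hLK, ε₀ := eps0 S₀.g,
      hK := by rw [mul_div_assoc']; exact mul_div_cancel_left₀ _ hLK.ne', g := S₀.g, g_pos := hg, gK_le_one := hge }
  have hβ : betaTree 𝔊 S = (L : ℝ) ^ K / c := by simp only [betaTree, Scales.g0sq, hc, S]; field_simp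
  have h := hB (show betaTree 𝔊 S ∈ balabanCouplings L 𝔊 eps0 from ⟨⟨S, rfl⟩, rfl⟩)
  rw [hβ, div_le_iff₀ hc0] at h
  exact absurd h (not_le.mpr hK)

/-- **Linear block factor along the family (PROVED): `L^{K+M'} ≤ (N·L^{M'}) · β_S`.**  Bałaban's `K` steps plus `M'` further
`L`-block steps have block factor `b = L^{K+M'} ≤ C_b · β_S` with `C_b = N·L^{M'}` UNIFORMLY on the family, because
`β_S = L^K/(N g²ε₀)` and `g²ε₀ ≤ 1` (`Scales.gK_le_one`): the `b(β) ≤ C_b β` clause of theory-2's `EntersClusterDomain` for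
Bałaban's averaging followed by a fixed number of extra steps. [cite: Balaban1985UV3, p.256 L15–18] -/
theorem pow_le_mul_betaTree (𝔊 : GroupModel G) (S : Scales L) (M' : ℕ) :
    ((L ^ (S.K + M') : ℕ) : ℝ) ≤ ((𝔊.N : ℝ) * (L : ℝ) ^ M') * betaTree 𝔊 S := by
  have hε : 0 < S.ε := S.ε_pos; have hg : S.g ≠ 0 := S.g_pos.ne'; have hN : (0 : ℝ) < 𝔊.N := by exact_mod_cast 𝔊.N_pos
  have hLK : (L : ℝ) ^ S.K = S.ε₀ / S.ε := by rw [eq_div_iff hε.ne']; exact S.hK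
  push_cast; rw [pow_add, hLK]
  calc S.ε₀ / S.ε * (L : ℝ) ^ M' = (S.g ^ 2 * S.ε₀) * ((L : ℝ) ^ M' / (S.g ^ 2 * S.ε)) := by field_simp
    _ ≤ 1 * ((L : ℝ) ^ M' / (S.g ^ 2 * S.ε)) := mul_le_mul_of_nonneg_right S.gK_le_one (by positivity)
    _ = ((𝔊.N : ℝ) * (L : ℝ) ^ M') * betaTree 𝔊 S := by unfold betaTree Scales.g0sq; field_simp

variable [HaarData G] [TopologicalSpace G] [IsTopologicalGroup G] [CompactSpace G] [BorelSpace G]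

/-- **FACTORISATION PREDICATE (HYPOTHESIS SHAPE, never asserted; CONJECTURE as to its inhabitation).** `W` FACTORS THROUGH
Bałaban's averaging of `mk` (model `𝔊`, terminal spacing `eps0`) if at every Bałaban pair (`β_S = 1/(N g²ε)`, fine side
`2L^{m+K}`) and every coarse side `M` with `b(β_S)·M = 2L^{m+K}`, W's coarse law `coarseFamily ρ β_S W M` is the push-forward
of `coarseLaw 𝔊 (mk G 𝔊 S) K` (the Wilson law averaged `K` times à la Bałaban; density `ρ_K/Z^ε` by `integral_coarseLaw`)
under a MEASURABLE map `post` of the terminal unit-lattice field (the «`M'` further steps» of `EntersClusterDomain`).  The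
clause under which `Crossover3`'s consequent can use its antecedent `BalabanUV3 mk` at all (a wild `W` fails it); its
inhabitation (Bałaban's (15) made measurable, total in `(β, M)`, `K` read off `β`) is a CONSTRUCTION statement, owed. [cite: Balaban1985Averaging, (15) p.19] -/
@[conjecture] def FactorsThroughAveraging (W : BlockFamily G) (mk : Construction L) (𝔊 : GroupModel G) (eps0 : ℝ → ℝ) :
    Prop :=
  ∀ (S : Family L eps0) (M : ℕ) [NeZero M], W.factor (betaTree 𝔊 S.1) * M = S.1.P.sitesPerDir 0 →
    ∃ post : GaugeConfig 3 (S.1.P.sitesPerDir S.1.K) G → GaugeConfig 3 M G, Measurable post ∧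
      coarseFamily 𝔊.ρ (betaTree 𝔊 S.1) W M = (coarseLaw 𝔊 (mk G 𝔊 S.1) S.1.K).map post

/-- **What factorisation buys (PROVED): theory-2's coarse law at a Bałaban pair IS `ρ_K dV/Z^ε` pushed forward** — for
bounded measurable `F`, `∫ F d(coarseFamily ρ β_S W M) = (Z^ε)⁻¹ ∫ ρ_K(V) F(post(configEquiv V)) dV`; so `B.Mem M (coarseFamily
ρ β_S W M)` in `EntersClusterDomain` speaks about Bałaban's terminal density (41)/(47) after `M'` more steps — exactly the
NOT-in-print content named there, nothing else.  Assumptions `hHaar`, `hA`, `hav`, `hint` as in §3. [cite: Balaban1985UV3, (2), (6) pp.256–257] -/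
theorem integral_coarseFamily_of_factors {W : BlockFamily G} {mk : Construction L} {𝔊 : GroupModel G} {eps0 : ℝ → ℝ}
    (hW : FactorsThroughAveraging W mk 𝔊 eps0) (hHaar : (HaarData.haar : Measure G) = haarProbability G)
    (S : Family L eps0) (hA : Measurable (wilsonAction (d := 3) (L := S.1.P.sitesPerDir 0) (G := G) 𝔊.ρ))
    (hav : ∀ j, Measurable ((mk G 𝔊 S.1).av j).avg)
    (hint : ∀ j, j < S.1.K → Integrable ((mk G 𝔊 S.1).rho j) (fieldMeasure S.1.P j G))
    (M : ℕ) [NeZero M] (hb : W.factor (betaTree 𝔊 S.1) * M = S.1.P.sitesPerDir 0)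
    (F : GaugeConfig 3 M G → ℝ) (hF : Measurable F) (hFb : ∃ C : ℝ, ∀ V, |F V| ≤ C) :
    ∃ post : GaugeConfig 3 (S.1.P.sitesPerDir S.1.K) G → GaugeConfig 3 M G, Measurable post ∧
      coarseFamily 𝔊.ρ (betaTree 𝔊 S.1) W M = (coarseLaw 𝔊 (mk G 𝔊 S.1) S.1.K).map post ∧
      ∫ V, F V ∂(coarseFamily 𝔊.ρ (betaTree 𝔊 S.1) W M) = ((mk G 𝔊 S.1).Zeps)⁻¹ *
        ∫ V, (mk G 𝔊 S.1).rho S.1.K V * F (post (transport S.1 G S.1.K V)) ∂(fieldMeasure S.1.P S.1.K G) := by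
  obtain ⟨post, hpost, hlaw⟩ := hW S M hb
  refine ⟨post, hpost, hlaw, ?_⟩
  obtain ⟨C, hC⟩ := hFb
  rw [hlaw, integral_map hpost.aemeasurable hF.aestronglyMeasurable]
  exact integral_coarseLaw 𝔊 (mk G 𝔊 S.1) hHaar hA hav S.1.K hint (fun V => F (post V)) (hF.comp hpost)
    ⟨C, fun V => hC _⟩
end Summit.Ventures.YMGap.YM3IR.CarrierBridge

end
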